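import Summits.BirchSwinnertonDyer.Rank1Residual.GaloisImage.SmallImageNiveauTwoSupersingular
import HarnessLib

/-!
# The CENTRAL INVOLUTION of inertia at a supersingular prime: `−1 ∈ ρ̄_{E,p}(I_𝔓)` at a good
# supersingular odd `p` and on its quadratic twists — O8-TAME part 11a
# (cell `b2b-bsdres`, lane CLASS-CLOSURE, seat cc-typer-1 = typer of record N11 / O8, GEN 10; joint
# small-image axis O8 / N2 / N3; sequel `SupersingularTwistInertiaOrder.lean` = part 11b)

HONEST FRAMING (cell `b2b-bsdres`, run/shared/lean/b2b/bsd-rank1-residual/, verbatim in every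
file): the goal of the cell is to DELETE the COMBINATION-SHAPED residual classes of the
Birch–Swinnerton-Dyer formula for ALL analytic-rank `≤ 1` elliptic curves over `ℚ` — "full BSD
formula for every rank `≤ 1` curve in class `C`" assembled STRICTLY from published theorems — so
that the rank-`≤ 1` remainder becomes exactly the CONSTRUCTION-SHAPED classes, which are TYPED
(missing-input `Prop`s), NOT attempted. This is not "finishing BSD". THEOREMS ONLY: no definition,
no named fact, no conjecture node, nothing booked, no label of `RESIDUAL-MAP.md` moved; census
counts are EVIDENCE, never a Literature fact.

## What this file does

GEN 9's `SmallImageNiveauTwoSupersingular.lean` proved that at a good SUPERSINGULAR odd `p` (and on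
its quadratic twists, the `(G) ∧ ss` rows) `E[p]` has NO `I_𝔓`-stable line. This file extracts the
element of the inertia image that the sequel (`e_p = p² − 1` EXACTLY; Sakamoto's (H.3) at level one
without surjectivity) runs on:

* §1 (pure algebra on `E[p]`, `#E[p] = p²`) **`smul_eq_neg_of_not_exists_stableLine`** — if `E[p]`
  has NO `H`-stable line, then any `z ∈ Γ_ℚ` acting on `E[p]` as a NON-TRIVIAL INVOLUTION commuting
  with the action of `H` acts as `−1` (its fixed subgroup `E[p]^z ∋ zP₀ + P₀ ≠ 0` would be a proper
  non-zero subgroup, i.e. a line, and `H`-stable).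
* §2 **`exists_generator_sq_pow_smul_eq_neg_of_goodSS`** / **`exists_mem_inertia_smul_eq_neg_of_goodSS`**
  — `W/ℚ` globally minimal, `p` odd, `GoodSS W p`: at EVERY `𝔓 ∣ p` some `z ∈ I_𝔓` acts as `−1` on
  `E[p]` ("`−1 ∈ ρ̄_{E,p}(I_𝔓)`"). The inertia image at the place's prime is cyclic of order `p² − 1`
  with one tame generator `s` (tree `isCyclic_and_card_inertia_map_of_dvd_frobeniusTrace` = Serre 1972
  §1.11 Prop. 12, GEN 8 `exists_card_inertia_map_eq_orderOf_of_not_dvd_card`); `8 ∣ p² − 1`, so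
  `z = (s²)^j = s^{(p²−1)/2}` is a non-trivial involution commuting with the (cyclic) image, and §1
  applies; conjugation (`Γ_ℚ` transitive on the primes above `p`) moves it to every `𝔓`. Because `z`
  is an EVEN power of `s` it passes through the signed twisting isomorphism `t : E[p] ≃+ E^{(d)}[p]`
  (n1011-p04's `exists_torsion_addEquiv_signed_of_model_twist`; `t(s² x) = s² t(x)` whatever the sign
  of `s`): **`exists_mem_inertia_smul_eq_neg_of_goodSS_twist`** — ONE `z ∈ I_𝔓` acting as `−1` on
  BOTH `E[p]` and `E^{(d)}[p]` when a `ℚ`-model of `E^{(d)}` is good supersingular at `p`.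

NOT claimed: anything at `p = 2`; `−1 ∈ ρ̄_{E,p^{k+1}}(I_𝔓)` for `k ≥ 1`; anything on ordinary /
multiplicative rows (there `−1 ∉ ρ̄(I_𝔓)` in general); any class theorem of BSD type; no label moves.

References: [Serre1972] J.-P. Serre, Invent. Math. 15 (1972) §1.3 Prop. 1–2, §1.11 Prop. 12;
[SerreLocalFields1979] Ch. IV §2 Cor. 1–3; [SilvermanAEC2009] *AEC* III.6.4(b), X.5 Cor. 5.4;
[NeukirchANT1999] Ch. I §9 (9.1), (9.4).
-/

set_option autoImplicit false

noncomputable section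

open scoped Classical NumberField Pointwise

open Field IsDedekindDomain NumberField WeierstrassCurve
  Literature.NumberTheory.EllipticCurves Literature.NumberTheory.GaloisRepresentations
  Literature.NumberTheory.EllipticCurves.Rank1Residual Rat.HeightOneSpectrum
  Summit.BirchSwinnertonDyer.Rank1Residual.Additive

namespace Summit.BirchSwinnertonDyer.Rank1Residual.GaloisImage

/-! ## §1. An involution commuting with a niveau-2 action is `−1` -/

section Involution

variable {W : WeierstrassCurve ℚ} [W.IsElliptic] {p : ℕ} [hp : Fact p.Prime]

/-- **An involution of `E[p]` commuting with an action WITHOUT stable lines is `−1`.** Let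
`H ≤ Γ_ℚ` have NO stable line in `E[p]` (niveau 2). If `z ∈ Γ_ℚ` acts on `E[p]` as an involution
(`z² = 1`), non-trivially, and commutes with every `σ ∈ H`, then `z` acts as `−1`: otherwise the fixed
subgroup `E[p]^z ∋ zP₀ + P₀ ≠ 0` is proper (`z ≠ 1`), hence a line (`#E[p] = p²`), and `H`-stable.
[cite: SilvermanAEC2009, Cor. III.6.4(b)] [cite: Serre1972, §1.11] -/
theorem smul_eq_neg_of_not_exists_stableLine (H : Subgroup (absoluteGaloisGroup ℚ))
    (hno : ¬ ∃ L : AddSubgroup (geomTorsion W (p : ℤ)), Nat.card L = p ∧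
      ∀ σ ∈ H, ∀ P ∈ L, σ • P ∈ L)
    (z : absoluteGaloisGroup ℚ)
    (hcomm : ∀ σ ∈ H, ∀ P : geomTorsion W (p : ℤ), z • σ • P = σ • z • P)
    (hz2 : ∀ P : geomTorsion W (p : ℤ), z • z • P = P)
    (hz1 : ∃ P : geomTorsion W (p : ℤ), z • P ≠ P) :
    ∀ P : geomTorsion W (p : ℤ), z • P = -P := by
  have hpP : p.Prime := hp.out
  by_contra h
  push Not at h
  obtain ⟨P₀, hP₀⟩ := h
  -- the fixed subgroup of `z`
  let L : AddSubgroup (geomTorsion W (p : ℤ)) :=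
    { carrier := {P | z • P = P}
      add_mem' := fun {a b} ha hb ↦ by
        simp only [Set.mem_setOf_eq] at ha hb ⊢
        rw [smul_add, ha, hb]
      zero_mem' := by simp only [Set.mem_setOf_eq, smul_zero]
      neg_mem' := fun {a} ha ↦ by
        simp only [Set.mem_setOf_eq] at ha ⊢
        rw [smul_neg, ha] }
  have hmemL : ∀ P : geomTorsion W (p : ℤ), P ∈ L ↔ z • P = P := fun P ↦ Iff.rfl
  -- `z P₀ + P₀` is a non-zero fixed point
  have hQ : z • P₀ + P₀ ∈ L := by
    rw [hmemL, smul_add, hz2, add_comm]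
  have hQ0 : z • P₀ + P₀ ≠ 0 := fun h0 ↦ hP₀ (eq_neg_of_add_eq_zero_left h0)
  -- `#L = p`
  have hE : Nat.card (geomTorsion W (p : ℤ)) = p ^ 2 :=
    Literature.NumberTheory.EllipticCurves.natCard_geomTorsion W p
  haveI : Finite (geomTorsion W (p : ℤ)) :=
    Nat.finite_of_card_ne_zero (by rw [hE]; exact pow_ne_zero 2 hpP.ne_zero)
  have hdvd : Nat.card L ∣ p ^ 2 := hE ▸ AddSubgroup.card_addSubgroup_dvd_card L
  obtain ⟨i, hi, hci⟩ := (Nat.dvd_prime_pow hpP).mp hdvd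
  have hLbot : L ≠ ⊥ := by
    intro hb
    have : z • P₀ + P₀ ∈ (⊥ : AddSubgroup (geomTorsion W (p : ℤ))) := hb ▸ hQ
    exact hQ0 (AddSubgroup.mem_bot.mp this)
  have hLtop : L ≠ ⊤ := by
    obtain ⟨P₁, hP₁⟩ := hz1
    intro ht
    have : P₁ ∈ L := ht ▸ AddSubgroup.mem_top P₁
    exact hP₁ ((hmemL P₁).mp this)
  have hcard : Nat.card L = p := by
    interval_cases i
    · exact absurd (AddSubgroup.eq_bot_of_card_eq L (by rw [hci, pow_zero])) hLbot
    · rw [hci, pow_one]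
    · exact absurd (AddSubgroup.eq_top_of_card_eq L (by rw [hci, hE])) hLtop
  -- `L` is `H`-stable
  exact hno ⟨L, hcard, fun σ hσ P hP ↦ (hmemL _).mpr (by rw [hcomm σ hσ P, (hmemL P).mp hP])⟩

end Involution

/-! ## §2. `−1 ∈ ρ̄_{E,p}(I_𝔓)` at a good supersingular odd `p`, and on its quadratic twists -/

section Supersingular

variable {W : WeierstrassCurve ℚ} [W.IsElliptic] [W.IsGloballyMinimal] {p : ℕ} [hp : Fact p.Prime]

/-- **The even-power involution at the place's prime.** For `W/ℚ` globally minimal, `p` odd,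
`GoodSS W p`, and `𝔓₀` the prime of `ℤ̄` cut out by `placeOver p`: there is `s ∈ I_{𝔓₀}` generating
`ρ̄_{E,p}(I_{𝔓₀})` (every `x ∈ I_{𝔓₀}` acts as a power of `s`) and `j` with `(s²)^j = s^{(p²−1)/2}`
acting as `−1` on `E[p]`. (`ρ̄(I_{𝔓₀})` is cyclic of order `p² − 1`, `8 ∣ p² − 1`; `s^{(p²−1)/2}` is a
non-trivial involution commuting with the image; no stable line (GEN 9) + §1.)
[cite: Serre1972, §1.11 Prop. 12 and §1.3 Prop. 1–2] [cite: SerreLocalFields1979, Ch. IV §2 Cor. 1–3] -/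
theorem exists_generator_sq_pow_smul_eq_neg_of_goodSS (hp2 : p ≠ 2) (hss : GoodSS W p)
    {v : HeightOneSpectrum (𝓞 ℚ)} (hv : ((p : ℕ) : 𝓞 ℚ) ∈ v.asIdeal)
    {𝔓₀ : Ideal (absIntegers (𝓞 ℚ) ℚ)}
    (hmem₀ : ∀ x : absIntegers (𝓞 ℚ) ℚ, x ∈ 𝔓₀ ↔ (x : AlgebraicClosure ℚ) ∈ (placeOver p).nonunits)
    (h𝔓₀ : 𝔓₀ ∈ v.primesAbove) :
    ∃ s ∈ 𝔓₀.inertia (absoluteGaloisGroup ℚ),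
      (∀ x ∈ 𝔓₀.inertia (absoluteGaloisGroup ℚ), ∃ k : ℤ,
        galoisRepTorsion W p x = galoisRepTorsion W p s ^ k) ∧
      ∃ j : ℕ, ∀ P : geomTorsion W (p : ℤ), (s ^ 2) ^ j • P = -P := by
  have hp' : p.Prime := hp.out
  have hvp : (primesEquiv v : ℕ) = p := by
    rw [(natCast_mem_asIdeal_iff_eq_primesEquiv_symm v hp').mp hv, Equiv.apply_symm_apply]
  -- `ρ̄(I_{𝔓₀})` is cyclic of order `p² − 1`
  have hΔ : ¬ (p : ℤ) ∣ minimalDiscriminantInt W :=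
    W.not_dvd_minimalDiscriminantInt_of_hasGoodReductionAtPrime' p hss.1
  have hT : ∀ π ζ : AlgebraicClosure ℚ, π ^ (p ^ 2 - 1) = p → ζ ^ (p ^ 2 - 1) = 1 →
      ∃ s ∈ 𝔓₀.inertia (absoluteGaloisGroup ℚ), s • π = ζ * π := fun π ζ hπ hζ ↦
    exists_mem_inertia_smul_eq_mul_of_pow_eq p
      (Nat.sub_pos_of_lt (Nat.one_lt_pow two_ne_zero hp'.one_lt)) hvp h𝔓₀ hπ hζ
  obtain ⟨-, hcard⟩ :=
    isCyclic_and_card_inertia_map_of_dvd_frobeniusTrace p hΔ hss.2 hp2 hmem₀ hT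
  obtain ⟨hnd, -⟩ := not_dvd_sq_sub_one_and (p := p)
  have hI : ¬ p ∣ Nat.card ((𝔓₀.inertia (absoluteGaloisGroup ℚ)).map (galoisRepTorsion W p)) := by
    rw [hcard]; exact hnd
  obtain ⟨s, hsI, hgen, hord⟩ := exists_card_inertia_map_eq_orderOf_of_not_dvd_card hv h𝔓₀ hI
  have hos : orderOf (galoisRepTorsion W p s) = p ^ 2 - 1 := hord.symm.trans hcard
  -- `p² − 1 = 2 · (2 j)` with `j = (p² − 1)/4`
  have h8 : 8 ∣ p ^ 2 - 1 := by
    have hodd : Odd p := hp'.odd_of_ne_two hp2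
    obtain ⟨k, hk⟩ := hodd
    have : p ^ 2 - 1 = 4 * (k * (k + 1)) := by
      rw [hk]; ring_nf; omega
    rw [this]
    have h2 : 2 ∣ k * (k + 1) := Nat.even_mul_succ_self k |>.two_dvd
    exact mul_dvd_mul (dvd_refl 4) h2 |> fun h ↦ by simpa using h
  obtain ⟨j, hj⟩ : ∃ j : ℕ, p ^ 2 - 1 = 2 * (2 * j) := by
    obtain ⟨c, hc⟩ := h8
    exact ⟨2 * c, by rw [hc]; ring⟩
  refine ⟨s, hsI, hgen, j, ?_⟩
  -- the involution `z = (s²)^j = s^{2j}`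
  have hz : (s ^ 2) ^ j = s ^ (2 * j) := (pow_mul s 2 j).symm
  have hz2 : ∀ P : geomTorsion W (p : ℤ), (s ^ 2) ^ j • (s ^ 2) ^ j • P = P := by
    intro P
    rw [← mul_smul, hz, ← pow_add, ← two_mul, ← hj]
    have h1 : galoisRepTorsion W p (s ^ (p ^ 2 - 1)) = 1 := by
      rw [map_pow, ← hos, pow_orderOf_eq_one]
    exact (galoisRepTorsion_eq_one_iff' W p _).mp h1 P
  have hz1 : ∃ P : geomTorsion W (p : ℤ), (s ^ 2) ^ j • P ≠ P := by
    by_contra h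
    push Not at h
    have h1 : galoisRepTorsion W p (s ^ (2 * j)) = 1 :=
      (galoisRepTorsion_eq_one_iff' W p _).mpr (by rw [← hz]; exact h)
    rw [map_pow] at h1
    have hdvd : p ^ 2 - 1 ∣ 2 * j := hos ▸ orderOf_dvd_of_pow_eq_one h1
    have hjpos : 0 < 2 * j := by
      have : 0 < p ^ 2 - 1 := Nat.sub_pos_of_lt (Nat.one_lt_pow two_ne_zero hp'.one_lt)
      omega
    have := Nat.le_of_dvd hjpos hdvd
    omega
  have hcomm : ∀ σ ∈ 𝔓₀.inertia (absoluteGaloisGroup ℚ), ∀ P : geomTorsion W (p : ℤ),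
      (s ^ 2) ^ j • σ • P = σ • (s ^ 2) ^ j • P := by
    intro σ hσ P
    obtain ⟨k, hk⟩ := hgen σ hσ
    have hc : galoisRepTorsion W p ((s ^ 2) ^ j * σ) = galoisRepTorsion W p (σ * (s ^ 2) ^ j) := by
      rw [map_mul, map_mul, hk, hz, map_pow]
      exact ((Commute.refl (galoisRepTorsion W p s)).zpow_right k).pow_left (2 * j) |>.eq
    have h1 := congrArg (fun φ ↦ (Multiplicative.toAdd φ) P) hc
    simp only [galoisRepTorsion_apply, mul_smul] at h1
    exact h1
  exact smul_eq_neg_of_not_exists_stableLine (𝔓₀.inertia (absoluteGaloisGroup ℚ))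
    (not_exists_inertia_stableLine_of_goodSS hp2 hss hv h𝔓₀) _ hcomm hz2 hz1

/-- **`−1 ∈ ρ̄_{E,p}(I_𝔓)` at a good SUPERSINGULAR odd prime, every `𝔓 ∣ p`.** For `W/ℚ` globally
minimal elliptic, `p ≠ 2`, `GoodSS W p`: some `z ∈ I_𝔓` acts as `−1` on `E[p]` (§2 at the place's
prime, conjugated to `𝔓` by the transitivity of `Γ_ℚ` on the primes above `p`).
[cite: Serre1972, §1.11 Prop. 12] [cite: NeukirchANT1999, Ch. I §9 Prop. (9.1) and (9.4)] -/
theorem exists_mem_inertia_smul_eq_neg_of_goodSS (hp2 : p ≠ 2) (hss : GoodSS W p)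
    {v : HeightOneSpectrum (𝓞 ℚ)} (hv : ((p : ℕ) : 𝓞 ℚ) ∈ v.asIdeal)
    {𝔓 : Ideal (absIntegers (𝓞 ℚ) ℚ)} (h𝔓 : 𝔓 ∈ v.primesAbove) :
    ∃ z ∈ 𝔓.inertia (absoluteGaloisGroup ℚ), ∀ P : geomTorsion W (p : ℤ), z • P = -P := by
  have hp' : p.Prime := hp.out
  have hvp : (primesEquiv v : ℕ) = p := by
    rw [(natCast_mem_asIdeal_iff_eq_primesEquiv_symm v hp').mp hv, Equiv.apply_symm_apply]
  obtain ⟨𝔓₀, hmem₀, h𝔓₀⟩ := exists_ideal_placeOver p hvp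
  obtain ⟨s, hsI, -, j, hneg⟩ := exists_generator_sq_pow_smul_eq_neg_of_goodSS hp2 hss hv hmem₀ h𝔓₀
  obtain ⟨g, hg⟩ :=
    HeightOneSpectrum.exists_smul_eq_of_mem_primesAbove_holds (K := ℚ) (v := v) h𝔓₀ h𝔓
  refine ⟨g * (s ^ 2) ^ j * g⁻¹, ?_, fun P ↦ ?_⟩
  · rw [← hg]
    exact (Ideal.conj_mem_inertia_smul_iff 𝔓₀ g _).mpr (Subgroup.pow_mem _ (Subgroup.pow_mem _ hsI 2) j)
  · rw [mul_smul, mul_smul, hneg, smul_neg, smul_inv_smul]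

/-- **One element of `I_𝔓` acting as `−1` on BOTH `E[p]` and `E^{(d)}[p]`**, when some `ℚ`-model `Wd`
of the quadratic twist `E^{(d)}` (`C • W.quadraticTwist d = Wd`, `d ≠ 0`, `Wd` globally minimal) has
`GoodSS Wd p`, `p ≠ 2`; every `𝔓 ∣ p`. The even power `(s²)^j` of §2 commutes with the signed
twisting isomorphism `t : E[p] ≃+ E^{(d)}[p]` (`t(s² x) = s² t(x)` whatever the sign of `s`).
[cite: Serre1972, §1.11 Prop. 12] [cite: SilvermanAEC2009, X.5 Cor. 5.4] -/
theorem exists_mem_inertia_smul_eq_neg_of_goodSS_twist {V : WeierstrassCurve ℚ} (hp2 : p ≠ 2)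
    {d : ℚ} (hd : d ≠ 0) (Wd : WeierstrassCurve ℚ) [Wd.IsElliptic] [Wd.IsGloballyMinimal]
    (hWd : ∃ C : VariableChange ℚ, C • V.quadraticTwist d = Wd) (hss : GoodSS Wd p)
    {v : HeightOneSpectrum (𝓞 ℚ)} (hv : ((p : ℕ) : 𝓞 ℚ) ∈ v.asIdeal)
    {𝔓 : Ideal (absIntegers (𝓞 ℚ) ℚ)} (h𝔓 : 𝔓 ∈ v.primesAbove) :
    ∃ z ∈ 𝔓.inertia (absoluteGaloisGroup ℚ),
      (∀ P : geomTorsion V (p : ℤ), z • P = -P) ∧ ∀ P : geomTorsion Wd (p : ℤ), z • P = -P := by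
  have hp' : p.Prime := hp.out
  have hvp : (primesEquiv v : ℕ) = p := by
    rw [(natCast_mem_asIdeal_iff_eq_primesEquiv_symm v hp').mp hv, Equiv.apply_symm_apply]
  obtain ⟨𝔓₀, hmem₀, h𝔓₀⟩ := exists_ideal_placeOver p hvp
  obtain ⟨s, hsI, -, j, hneg⟩ :=
    exists_generator_sq_pow_smul_eq_neg_of_goodSS (W := Wd) hp2 hss hv hmem₀ h𝔓₀
  obtain ⟨t, ht⟩ := exists_torsion_addEquiv_signed_of_model_twist V p Wd hd hWd
  -- `t` commutes with `s²`, hence with `(s²)^j`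
  have hts2 : ∀ x : geomTorsion V (p : ℤ), t (s ^ 2 • x) = s ^ 2 • t x := by
    intro x
    rcases ht s with h | h
    · rw [pow_two, mul_smul, h, h, mul_smul]
    · rw [pow_two, mul_smul, h, h, smul_neg, neg_neg, mul_smul]
  have htz : ∀ (n : ℕ) (x : geomTorsion V (p : ℤ)), t ((s ^ 2) ^ n • x) = (s ^ 2) ^ n • t x := by
    intro n
    induction n with
    | zero => intro x; simp only [pow_zero, one_smul]
    | succ n ih => intro x; rw [pow_succ, mul_smul, mul_smul, ih, hts2]
  have hnegV : ∀ P : geomTorsion V (p : ℤ), (s ^ 2) ^ j • P = -P := fun P ↦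
    t.injective (by rw [htz j, hneg, map_neg])
  obtain ⟨g, hg⟩ :=
    HeightOneSpectrum.exists_smul_eq_of_mem_primesAbove_holds (K := ℚ) (v := v) h𝔓₀ h𝔓
  refine ⟨g * (s ^ 2) ^ j * g⁻¹, ?_, fun P ↦ ?_, fun P ↦ ?_⟩
  · rw [← hg]
    exact (Ideal.conj_mem_inertia_smul_iff 𝔓₀ g _).mpr (Subgroup.pow_mem _ (Subgroup.pow_mem _ hsI 2) j)
  · rw [mul_smul, mul_smul, hnegV, smul_neg, smul_inv_smul]
  · rw [mul_smul, mul_smul, hneg, smul_neg, smul_inv_smul]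

end Supersingular

end Summit.BirchSwinnertonDyer.Rank1Residual.GaloisImage

end
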